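import Mathlib
import HarnessLib
import Summits.CriticalPhenomena.SAWScalingLimit.Theorems.SAWSpinMonotoneQCIdentificationDefs
import Summits.CriticalPhenomena.SAWScalingLimit.Theorems.SAWDevelopingMapPotentialExists

/-!
# Window identity (W) of line `eight_fifths_primitive` (crux `QCIdentification`, stmt-CriticalPhenomena-16772)

Helper sub-goal (W) of the registered stubs `stub_boundaryAmplitude` / `stub_rayCondition` of the
checked skeleton `Cruxes/QCIdentification/Lines/eight_fifths_primitive.lean` (vocabulary module
`SAWSpinMonotoneQCIdentificationDefs`, namespace `…EightFifthsPrimitive`; this file lives in the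
sub-namespace `…EightFifthsPrimitive.Window`).

* `rowEdge x = {(x,0), (x - e₁, 1)}` — the bottom-row mid-edge below the up face `(x, 0)` (the shape
  of the marked boundary mid-edge `b_δ` forced by the exact half-lattice rows of `Admissible`);
* `IsPotential Λ a H` — `H : Site 2 → ℂ` (values at the hexagon centres = sites of `𝕋`) is a
  developing map (potential) of `F = Fobs Λ a`: VERBATIM the relation of the proved route item
  `PotentialExists` (stmt-CriticalPhenomena-8299): across the `𝕋`-edge `{s, t}` dual to the mid-edge
  `{v, w}`, oriented with the centre of `v` on its left, `H t - H s = (m_{vw} - c_v) · F{v,w}`;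
* `rowEdge_offset` — the window constant `m_{p_x} - c_{(x,0)} = -i/(2√3) = -i√3/6`;
* `fobs_rowEdge_eq` — one edge: `F(p_x) = 2√3 i (H(x + e₀) - H x)` whenever `(x,0) ∈ Λ`;
* **`wi_windowIdentity : WindowIdentity`** — (W): for `N` consecutive up faces `(x + je₀, 0) ∈ Λ`
  of one row, `Σ_{j<N} F(p_{x+je₀}) = 2√3 i (H(x + Ne₀) - H x)` (telescoping; the hypothesis
  `(x + je₀ - e₁, 1) ∉ Λ` of the boundary-window reading is NOT needed and has been dropped, which
  makes the lemma stronger);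
* **`wi_exists_potential`** — existence of a potential for simply connected `Λ` and a boundary
  source `a`: `potentialExists_proof` read through `IsPotential` (definitional unfolding).

Sources: H. Duminil-Copin, S. Smirnov, Ann. of Math. 175 (2012) 1653–1665 (arXiv:1007.0575), Lemma 1
and p. 7 (the potential behind Lemma 1; Conjecture 2's normalisation at `b`).
-/

noncomputable section

open scoped BigOperators
open Literature.Probability.LatticeModels Literature.Probability.RandomPlanarGeometry
open Literature.Probability.RandomPlanarGeometry.SAW

namespace Summit.CriticalPhenomena.SAWScalingLimit.Cruxes.QCIdentification.EightFifthsPrimitive.Window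

/-! ## Statements -/

/-- The bottom-row boundary mid-edge below the up face `(x,0)`: `p_x = {(x,0), (x - e₁, 1)}`. -/
def rowEdge (x : Site 2) : Sym2 HexVertex := s((x, 0), (x - Pi.single 1 1, 1))

/-- `H : Site 2 → ℂ` is a developing map (potential) of `F = Fobs Λ a`: verbatim the relation of
`PotentialExists` (across the `𝕋`-edge `{s,t}` dual to the mid-edge `{v,w}`, oriented with the centre
of `v` on its left, `H t - H s = (m_{vw} - c_v)·F{v,w}`). -/
def IsPotential (Λ : Finset HexVertex) (a : Sym2 HexVertex) (H : Site 2 → ℂ) : Prop :=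
  ∀ v ∈ Λ, ∀ w : HexVertex, hexGraph.Adj v w → ∀ s t : Site 2,
    s ∈ hexFaceVertices v → t ∈ hexFaceVertices v → s ∈ hexFaceVertices w → t ∈ hexFaceVertices w →
    s ≠ t → 0 < ((starRingEnd ℂ) (triEmbed t - triEmbed s) * (hexCenter v - triEmbed s)).im →
    H t - H s = (hexMidpoint s(v, w) - hexCenter v) * Fobs Λ a s(v, w)

/-- **(W) Window identity.** For a potential `H` of `F` and `N` consecutive up faces
`(x + je₀, 0) ∈ Λ` (`j < N`) of one row, the window sum of the values of `F` on the bottom-row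
mid-edges `p_{x+je₀}` is an increment of `H` along the row:
`Σ_{j<N} F(p_{x+je₀}) = 2√3 i (H(x + Ne₀) - H x)`. -/
def WindowIdentity : Prop :=
  ∀ (Λ : Finset HexVertex) (a : Sym2 HexVertex) (H : Site 2 → ℂ), IsPotential Λ a H →
    ∀ (x : Site 2) (N : ℕ),
      (∀ j : ℕ, j < N → ((x + Pi.single 0 (j : ℤ), 0) : HexVertex) ∈ Λ) →
      ∑ j ∈ Finset.range N, Fobs Λ a (rowEdge (x + Pi.single 0 (j : ℤ))) =
        2 * (Real.sqrt 3 : ℂ) * Complex.I * (H (x + Pi.single 0 (N : ℤ)) - H x)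

/-! ## The window constant -/

/-- The window constant: `hexMidpoint p_x - hexCenter (x,0) = -i/(2√3) = -i√3/6`. [folklore] -/
theorem rowEdge_offset (x : Site 2) :
    hexMidpoint (rowEdge x) - hexCenter ((x, 0) : HexVertex) = -(Complex.I) * (Real.sqrt 3) / 6 := by
  have hζ : triZeta = 1 / 2 + (Real.sqrt 3 / 2 : ℝ) * Complex.I := by
    rw [triZeta]
    have : (Real.pi : ℂ) * Complex.I / 3 = ((Real.pi / 3 : ℝ) : ℂ) * Complex.I := by push_cast; ring
    rw [this, Complex.exp_mul_I, ← Complex.ofReal_cos, ← Complex.ofReal_sin, Real.cos_pi_div_three,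
      Real.sin_pi_div_three]
    push_cast; ring
  have h0 : (((0 : Fin 2) : ℕ) : ℂ) = 0 := by norm_num
  have h1 : (((1 : Fin 2) : ℕ) : ℂ) = 1 := by norm_num
  simp only [rowEdge, hexMidpoint_mk, hexCenter, triEmbed, Fin.isValue, Pi.sub_apply,
    Pi.single_eq_same, Pi.single_eq_of_ne (zero_ne_one), sub_zero, Int.cast_sub, Int.cast_one, hζ,
    h0, h1]
  push_cast
  ring

/-- `2√3 i · (-i√3/6) = 1`: the window constant is the reciprocal of `2√3 i`. [folklore] -/
theorem two_sqrt_three_I_mul_offset :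
    2 * (Real.sqrt 3 : ℂ) * Complex.I * (-(Complex.I) * (Real.sqrt 3) / 6) = 1 := by
  have h3 : ((Real.sqrt 3 : ℝ) : ℂ) ^ 2 = 3 := by
    rw [← Complex.ofReal_pow, Real.sq_sqrt (by norm_num : (0 : ℝ) ≤ 3)]; norm_num
  linear_combination (-(1 : ℂ) / 3 * ((Real.sqrt 3 : ℝ) : ℂ) ^ 2) * Complex.I_sq + (1 / 3 : ℂ) * h3

/-! ## One edge of the window -/

/-- The up face `(x, 0)` is adjacent to the down face `(x - e₁, 1)` below it. [folklore] -/
theorem rowEdge_adj (x : Site 2) : hexGraph.Adj ((x, 0) : HexVertex) (x - Pi.single 1 1, 1) :=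
  (hexGraph_adj_iff_of_snd_eq_zero_holds x _).2 (Or.inr (Or.inr rfl))

/-- **The increment of a potential across a bottom-row mid-edge.** If `H` is a potential of `F` and
`(x, 0) ∈ Λ`, then along the horizontal `𝕋`-edge `x → x + e₀` (dual to `p_x`, the centre of `(x,0)`
on its left) `H(x + e₀) - H x = (m_{p_x} - c_{(x,0)}) · F(p_x)`. [folklore] -/
theorem isPotential_rowEdge {Λ : Finset HexVertex} {a : Sym2 HexVertex} {H : Site 2 → ℂ}
    (hH : IsPotential Λ a H) {x : Site 2} (hx : ((x, 0) : HexVertex) ∈ Λ) :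
    H (x + Pi.single 0 1) - H x =
      (hexMidpoint (rowEdge x) - hexCenter ((x, 0) : HexVertex)) * Fobs Λ a (rowEdge x) := by
  have hs : x ∈ hexFaceVertices ((x, 0) : HexVertex) := mem_hexFaceVertices_zero.2 (Or.inl rfl)
  have ht : x + Pi.single 0 1 ∈ hexFaceVertices ((x, 0) : HexVertex) :=
    mem_hexFaceVertices_zero.2 (Or.inr (Or.inl rfl))
  have hs' : x ∈ hexFaceVertices ((x - Pi.single 1 1, 1) : HexVertex) :=
    mem_hexFaceVertices_one.2 (Or.inr (Or.inl (sub_add_cancel x _).symm))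
  have ht' : x + Pi.single 0 1 ∈ hexFaceVertices ((x - Pi.single 1 1, 1) : HexVertex) :=
    mem_hexFaceVertices_one.2 (Or.inr (Or.inr (by abel)))
  have hst : x ≠ x + Pi.single 0 1 := by
    intro h
    have h0 := congrArg (fun f : Site 2 => f 0) h
    simp at h0
  exact hH (x, 0) hx _ (rowEdge_adj x) x (x + Pi.single 0 1) hs ht hs' ht' hst
    (Summit.CriticalPhenomena.SAWScalingLimit.Theorems.PotentialExists.oriented_up_fst x)

/-- **One edge of the window.** If `H` is a potential of `F` and `(x, 0) ∈ Λ`, then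
`F(p_x) = 2√3 i · (H(x + e₀) - H x)`. [folklore] -/
theorem fobs_rowEdge_eq {Λ : Finset HexVertex} {a : Sym2 HexVertex} {H : Site 2 → ℂ}
    (hH : IsPotential Λ a H) {x : Site 2} (hx : ((x, 0) : HexVertex) ∈ Λ) :
    Fobs Λ a (rowEdge x) = 2 * (Real.sqrt 3 : ℂ) * Complex.I * (H (x + Pi.single 0 1) - H x) := by
  rw [isPotential_rowEdge hH hx, rowEdge_offset, ← mul_assoc, two_sqrt_three_I_mul_offset, one_mul]

/-! ## (W) and the existence of potentials -/

/-- **(W) Window identity** (registered helper `wi_windowIdentity` of stmt-CriticalPhenomena-16772):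
`Σ_{j<N} F(p_{x+je₀}) = 2√3 i (H(x + Ne₀) - H x)` for a potential `H` of `F` and up faces
`(x + je₀, 0) ∈ Λ`, `j < N` — the one-edge identity `fobs_rowEdge_eq` telescoped along the row. -/
theorem wi_windowIdentity : WindowIdentity := by
  intro Λ a H hH x N hrow
  induction N with
  | zero => simp
  | succ n ih =>
    rw [Finset.sum_range_succ, ih fun j hj => hrow j (Nat.lt_succ_of_lt hj),
      fobs_rowEdge_eq hH (hrow n n.lt_succ_self), add_assoc, ← Pi.single_add]
    push_cast
    ring

/-- **Existence of potentials** (registered helper `wi_exists_potential` of stmt-CriticalPhenomena-16772): for every simply connected `Λ` and boundary source `a` the observable `F = Fobs Λ a` has a potential — the proved route item `PotentialExists` (`potentialExists_proof`, stmt-CriticalPhenomena-8299), read through `IsPotential`. -/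
theorem wi_exists_potential : ∀ (Λ : Finset HexVertex), hexDomainSimplyConnected Λ → ∀ a ∈ hexDomainBoundary Λ, ∃ H : Site 2 → ℂ, IsPotential Λ a H :=
  Summit.CriticalPhenomena.SAWScalingLimit.Theorems.potentialExists_proof

end Summit.CriticalPhenomena.SAWScalingLimit.Cruxes.QCIdentification.EightFifthsPrimitive.Window

end
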